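import Summits.QuantumFields.YangMills.Theorems.BalabanUVNodesN19CoreEdgeU3InputsFromFaceAtPin
import Summits.QuantumFields.YangMills.Theorems.BalabanUVNodesN19RateEdgeHolderD4AtBareLedgerReadingV

/-!
# BalabanUVNodes ∕ N19 — THE FACE-KEYED N19′ SLOT AT THE CONSUMERS' FRONTIER READING: the witness reading `crOfRecord₁₃VAt K₀ (jc …) sh` with NODE O's share = its
# BARE ledger reading `hlinkBareV` (dag-n19-w3 g5 p639742) — node U3's share = the letter row ∀μν, the bit `0 < ρ` and the κ-threshold row; `hdecT`, `hunif`, `hs r hr hinc h9 hWall` GONE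

Cell `pub-ymgap`, HUMAN RULING D-0062 (Track A) ∕ D-0149 ∕ D-0154 (director-ym R399 (3a)), width seat `pub-ymgap-dag-n19-w5` (g3), FILE 10.  THEOREMS ONLY (0 `def`, 0 `instance`,
0 `sorry`); imports this seat's FILE 9 `BalabanUVNodesN19CoreEdgeU3InputsFromFaceAtPin` (p640885) and dag-n19-w3 g5's `BalabanUVNodesN19RateEdgeHolderD4AtBareLedgerReadingV` (p639742;
transitively `…AtCoreLedgerReadingV` p638503) — CITED BY NAME, nothing restated or edited; mirror-free; `--kind proof --supports` K3⁸ `SpineGivenEndpointR13SepCoPHV`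
(stmt-QuantumFields-27366) `--as helper` — COUNT-NEUTRAL.

WHY.  FILE 9 built the N19′ slot with its node-U3 inputs READ OFF STUB 1's FACE at the CORE ledger reading for a generic spine reading `cr`.  The N27 storeys and dag-n16-w4's producers
consume the slot at the WITNESS reading `S := crOfRecord₁₃VAt K₀ (jc F θ hP g₀ os) sh F θ hP g₀ os` with NODE O's displayed share reduced to its LEDGER WORLD PROPER `hlinkBareV`
(p639742 §2 = «the N19′-side bill of K3⁸ at its witness reading after g5»: pins · `hmatch hend` · `hs hr hinc h9` · `hκ₀` · `hβw` · `hWall` · `hradii ∧ hclass` · `hH3 hsel` · `2∕3 < β ≤ 1` ·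
`hlinkBareV`).  THIS FILE is that bill FACE-KEYED: ONE application each of FILE 9 §3∕§4 at `cr := fun … ↦ S`, NODE O's core reading there supplied by dag-n19-w3's two §1 reductions BY NAME
— `linkReadingAtCoreLedgerReadingV_of_linkReadingAtBareLedgerReadingV` (p639742: `hlinkBareV` + the per-tuple N07∕N16 rows `hH3 hsel` ⇒ `hlinkCoreV`) and
`linkReadingAtCoreLedgerReading_crOfRecord₁₃VAt_of_linkReadingAtCoreLedgerReadingV` (p638503: `hlinkCoreV` + the (t-U3) pin + the letter row `hκ₀` ⇒ `hlinkCore` at `S`).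

WHAT.
* §1 ★★★ `forSmallCouplings_h19HolderD4_crOfRecord₁₃VAt_of_linkReadingAtBareLedgerReadingV_of_kernelDecayAll` — N19′'s slot under the `ForSmallCouplings` prefix at the witness
  reading, bare ledger reading: dag-n19-w3's per-tuple hypothesis list (K1⁷ window `(γ₀ b b′)`, uniform letters `(M, ρ₁)`) with `hdecT` REPLACED by `h510`.
* §2 ★★★ `keyedCoreEdgeHolderD4BFree_crOfRecord₁₃VAt_of_linkReadingAtBareLedgerReadingV_of_kernelDecayAll_of_rhoPos` — p639742 §2's CONCLUSION VERBATIM (K3 «v6»'s (B)-free N19′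
  face `KeyedCoreEdgeHolderD4BFree β (fun … ↦ S) (rrOfRecord 𝔯 ks)` SPELLED) from: `hlinkBareV`, `hH3 hsel`, the three pins, `hmatch hend hradii hclass`, `2∕3 < β ≤ 1`, K1⁷'s window `hβw`
  — and on NODE U3's SIDE ONLY `h510` (limiting (5.10), 16 pairs), `hρ : 0 < (ℓ F θ).ρ`, `hκ₀ : kappa₀ 64 8 ≤ (ℓ F θ).κ`.  p639742 §2 asks node U3 for `hs r hr hinc h9 hWall hκ₀`.
* §3 ★★ `keyedCoreEdgeHolderD4BFree_crOfRecord₁₃VAt_of_linkReadingAtBareLedgerReadingV_of_windowedAll_of_signs` — §2 in STUB 1's OWN ROW CURRENCY: node U3's share = `hs` + `hL` +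
  `hWall` (windowed (5.10) at 16 pairs) + `hκ₀`; windowed NE9 `h9` (and `r hr hinc`, `hdecT`, `hunif`) NOT needed — limiting NE9 is read off the face.

LOCATED (count-neutral; K3 «v7» precut).  At the witness reading the node-U3 residue of `stub_expansion13HV` beyond stub 1's face, N19′ side, is EXACTLY the three `ℓ`-rows (R1)
`∀ μ ν, KernelDecayOfRecord₁₃ F N θ.toStage13Params μ ν (ℓ F θ).κ`, (R2) `0 < (ℓ F θ).ρ`, (R3) `kappa₀ 64 8 ≤ (ℓ F θ).κ` (each under `∀ F θ hP, G θ → θ.Admissible F N →`) — FILE 9's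
located paragraph, now at the frontier reading the consumers instantiate.  The remaining displayed rows are NODE O's (`hlinkBareV`), nodes N07∕N16's (`hH3 hsel`, `hmatch hend hradii
hclass`), node N14's pin, K1⁷'s window — none of them node U3's.

HONEST FRAMING.  By-name compositions of LANDED theorems over HYPOTHESIS shapes; ZERO estimate content; `hlinkBareV` = NODE O's ledger world at the record (UNPRINTED for d = 4; 0
instances), `hH3`∕`hsel` = N07∕N16's object-level statements (0 instances), (R1)(R2)(R3), node N16's rows, K1⁷'s window, the pins, `D.Tuned` are HYPOTHESES (K0⁷ OPEN); `K₀ jc sh`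
PARAMETERS (`sh` NOT inhabited); nothing of Bałaban's asserted or instantiated; (5.10)-at-the-record ∕ NE7 NOT PRINTED for d = 4 and NOT proved; N07 ∕ N14 ∕ N16 ∕ N18 ∕ N19 ∕ N22 NOT
discharged; no stub closed — NOT `stub_rates13HV`, NOT `stub_expansion13HV`; K3⁸ OPEN, NOT claimed, skeleton v6 UNTOUCHED; K3⁷ aside; counts UNMOVED (typed 28∕28 · discharged 5∕27 ·
A 5∕28).  One finite 𝕋⁴ at fixed ε — R4 closes the CONDITIONAL rung `BalabanLadder.UV` only; NOT ℝ⁴ ∕ continuum ∕ OS; the Yang–Mills mass gap (Clay) is NOT proved by any of this.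
[bookkeeping] throughout.
-/

set_option autoImplicit false

noncomputable section

open Finset MeasureTheory
open scoped BigOperators Matrix Matrix.Norms.L2Operator

namespace Summit.QuantumFields.YangMills.BalabanUVNodes.N19CoreEdgeU3InputsFromFaceAtBareReadingV

open Literature.MathematicalPhysics.QuantumFieldTheory.Balaban1983to89
open T4OutputRate T4RecentScale T4GoodClassBudget T4CauchySum T4TowerRateComposition T4TowerRateDischarge
open T4EtaRateMin (Readings NE3Shape)
open FlowStep (RGEqH prefixOf)
open TreeLengthTorus (TFaceConnected torusTreeLen)
open B12TreeDecay (kappa₀)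
open Summit.QuantumFields.BalabanUV.T4Continuum
open MinimalActionSandwich (IsMinimiser minAct)
open MinimalActionRate (sfClass)
open MinimalActionRefine (RegularSup gradConst)
open NE3.LeafIndexSockets (LeafH3sup)
open Summit.QuantumFields.BalabanUV.T4Continuum.Spine
open Summit.QuantumFields.BalabanUV.T4Continuum.Spine.NE4 (runFlow)
open Summit.QuantumFields.YangMills.BalabanUVNodes.N19LedgerLinkSync (LedgerDataSync LedgerAtSync)
open YMDAG.UVSplit (SpineCarriers U3Carriers RateCarriers N22At ReadOutAt ShellSplit₁₃CoPH crOfRecord₁₃VAt)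
open Summit.QuantumFields.YangMills.BalabanUVNodes.SpineRatesHolder (RatesHolderAt)
open Literature.MathematicalPhysics.QuantumFieldTheory.Balaban1983to89.T4Continuum (T4Family ULoop)
open YMDAG.UVSplit (Datum RateReading₁₃CoPH rateCarriersOfRecord₁₃CoPH)
open Node00 (Stage13HParams datumOfRecord₁₃CoPH NE3Letters₁₁ U3Letters₁₁)
open Summit.QuantumFields.YangMills.BalabanUVNodes.N16PinnedLayer13CoPH (N16PinnedLoose N16LettersEnd)
open Literature.MathematicalPhysics.QuantumFieldTheory.Balaban1983to89.Node00.U3OfKernels (objectsOfRecord₁₃ KernelDecayOfRecord₁₃)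
open T4ContinuumYM4Torus (ForSmallCouplings)
open YMDAG.N14.TopBorn (Ne1PinnedOfRecord)
open YMDAG.N22.AtKernels (kernelDecayOfRecord₁₃_of_windowed)
open Summit.QuantumFields.YangMills.BalabanUVNodes.N19UniformLettersAtU3Pin (rho_row_of_signs)
open Literature.MathematicalPhysics.QuantumFieldTheory.Balaban1983to89.Node00.U3KernelLetters (PolLimitsExistOfRecord₁₃ WindowedDecayOfRecord₁₃)
open Summit.QuantumFields.YangMills.BalabanUVNodes.N19CoreEdgeU3InputsFromFaceAtPin (forSmallCouplings_h19HolderD4_datumOfRecord₁₃CoPH_of_linkReadingAtCoreLedgerReading_of_kernelDecayAll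
  keyedCoreEdgeHolderD4BFree_of_linkReadingAtCoreLedgerReading_of_kernelDecayAll_of_rhoPos)
open Summit.QuantumFields.YangMills.BalabanUVNodes.N19RateEdgeHolderD4AtCoreLedgerReadingV (linkReadingAtCoreLedgerReading_crOfRecord₁₃VAt_of_linkReadingAtCoreLedgerReadingV)
open Summit.QuantumFields.YangMills.BalabanUVNodes.N19RateEdgeHolderD4AtBareLedgerReadingV (linkReadingAtCoreLedgerReadingV_of_linkReadingAtBareLedgerReadingV)

variable {N : ℕ} [NeZero N]

section AtBareLedgerReadingV

variable (K₀ : ℕ)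
  (jc : (F : T4Family) → (θ : Stage13HParams F N) → θ.Provisos₁₃CoPH F N → (ℕ → ℝ) → List (ULoop F) → ℕ → ℕ) (sh : ShellSplit₁₃CoPH N K₀)
  (𝔯 : RateReading₁₃CoPH N) (G : ∀ {F : T4Family}, Stage13HParams F N → Prop) {β : ℝ} (hβ1 : β ≤ 1)
  {ℓ₃ : T4Family → NE3Letters₁₁} {g B c' : T4Family → ℝ}

/-! ## §1 N19′'s slot under the `ForSmallCouplings` prefix at the witness reading, bare ledger reading, `hdecT` ↦ the letter row ∀μν -/

include hβ1 in
/-- ★★★ **N19′'s SLOT UNDER THE `ForSmallCouplings` PREFIX AT THE WITNESS READING `crOfRecord₁₃VAt K₀ (jc …) sh`, BARE LEDGER READING, `hdecT` ↦ THE LETTER ROW ∀μν** [bookkeeping]: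
FILE 9 §3 at `cr := fun F θ hP g₀ os ↦ crOfRecord₁₃VAt K₀ (jc F θ hP g₀ os) sh F θ hP g₀ os`, NODE O's core reading there = dag-n19-w3's p638503 §1 ∘ p639742 §1 (`hlinkBareV` + `hH3 hsel` +
the (t-U3) pin + `hκ₀`).  Hypotheses: `hlinkBareV`, `hH3 hsel`, `2∕3 < β ≤ 1`, the three pins, `hκ₀`, node N16's rows, `h510`, the tuple's K1⁷ window `(γ₀ b b′)` and uniform letters
`(M, ρ₁)` — dag-n19-w3's list with `hdecT` GONE.  All HYPOTHESES; NOT NE7; N07 ∕ N14 ∕ N16 ∕ N19 ∕ N22 NOT discharged; NOT `stub_expansion13HV`. -/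
theorem forSmallCouplings_h19HolderD4_crOfRecord₁₃VAt_of_linkReadingAtBareLedgerReadingV_of_kernelDecayAll
    (hlinkBareV : ∀ (F : T4Family) (θ : Stage13HParams F N) (hP : θ.Provisos₁₃CoPH F N), G θ → θ.Admissible F N →
    ∀ (γ gIR b : ℝ) (g₀ : ℕ → ℝ), (datumOfRecord₁₃CoPH F N θ hP).Tuned γ gIR g₀ → γ ≤ θ.γ → γ ^ 2 ≤ Real.exp (-1) → 0 < b →
    (∀ K m, 0 ≤ m → m < K → b ≤ (datumOfRecord₁₃CoPH F N θ hP).βfun m (prefixOf (runFlow (datumOfRecord₁₃CoPH F N θ hP) g₀ K) m)) →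
    ∀ (os : List (ULoop F)) (k : ℕ),
      let S : SpineCarriers := crOfRecord₁₃VAt K₀ (jc F θ hP g₀ os) sh F θ hP g₀ os
      let R : RateCarriers N := rateCarriersOfRecord₁₃CoPH 𝔯 F θ hP g₀ os k
      let D : Datum F N := datumOfRecord₁₃CoPH F N θ hP
      letI := S.dec
      ∃ (_ : DecidableEq R.u3.C.Dom) (F' : Type) (ι' X' : Type) (_ : MeasurableSpace ι')
        (L : LedgerDataSync R.u3.C F' ι' S.ι) (Rd : Readings ι' X') (bsel : (ℕ → ℝ) → ℝ) (EB : Functional R.u3.C R.u3.C.BgB)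
        (g : ℕ → ℕ → ℝ)
        (uA : ℕ → ι' → R.u3.C.BgA) (uB : ℕ → ι' → R.u3.C.BgB)
        (Koff : ℕ) (cells : (K j : ℕ) → R.u3.C.Dom → Finset (Site (F.P (Koff + K)) j))
        (θ : ℝ)
        (rd : ι' → (B7Prop1Explicit.Site 4 → Fin 4 → (Matrix (Fin N) (Fin N) ℂ)ˣ)),
        (∀ K i, i ≤ K → g K i = runFlow D g₀ K i) ∧ (∀ K i, K < i → g K i = gIR) ∧
        EB = (fun s => R.u3.EB (bsel s) s) ∧
        (∀ (Sz : ℕ → ℝ → S.ι → ℕ → ℝ) (E₀ : ℝ) (m : ℕ) (a : ℝ) (Cw Λg : ℝ),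
          (∀ K t, |t| ≤ S.l₀ → ∀ τ ∈ S.T K \ S.Bad K t, ∀ v ∈ Rd.dom, ∀ j ≤ K,
            |∑ X ∈ L.fac K t τ with R.u3.C.scale X = j,
                (Real.log (Real.exp (EB (fun i => g (K + 1) (i + 1)) (uB K v) X
                    - EB (fun i => g (K + 1) (i + 1)) L.oneB X))
                  - Real.log (Real.exp (R.u3.EA (g K) (uA K v) X - R.u3.EA (g K) L.oneA X)))| ≤ Sz K t τ j) →
          0 ≤ E₀ → 0 < a → a < 1 →
          (∀ K t, |t| ≤ S.l₀ → ∀ τ ∈ S.T K \ S.Bad K t, ∀ j ≤ K,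
            Sz K t τ j ≤ S.vol * (E₀ * ((K : ℝ) + 1) ^ m * a ^ (K - j))) →
          (∀ K, Multiplicity (L.All K) R.u3.C.scale (fun X => Real.exp (-(R.u3.κ * R.u3.C.d X))) Cw S.vol Λg K) →
          (∀ K t, |t| ≤ S.l₀ → ∀ τ ∈ S.T K \ S.Bad K t,
            WindowMultiplicity (L.facO K t τ) L.scO L.wO Cw S.vol Λg (jlogOf L.Cl K) K) →
          1 ≤ Λg → L.θ' ≤ Λg →
          LedgerAtSync { L with S := Sz, E₀ := E₀, m := m, a := a, Cw := Cw, Λg := Λg } S.l₀ S.vol S.T S.Bad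
            (fun K t τ => S.A K t τ - S.shA K t τ) (fun K t τ => S.B K t τ - S.shB K t τ) Rd R.u3.EA EB R.u3.κ g uA uB
            R.u3.ω R.u3.ρ R.u3.θ (θ ^ ((3 : ℝ) * β - 2))) ∧
        (∀ K t, |t| ≤ S.l₀ → ∀ τ ∈ S.T K \ S.Bad K t,
          WindowMultiplicity (L.facO K t τ) L.scO L.wO L.Cw S.vol L.Λg (jlogOf L.Cl K) K) ∧
        0 ≤ L.Cw ∧ 1 ≤ L.Λg ∧ L.θ' ≤ L.Λg ∧
        (∀ K, ∀ X ∈ L.All K,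
          (cells K (R.u3.C.scale X + Koff) X).Nonempty ∧ TFaceConnected (cells K (R.u3.C.scale X + Koff) X)) ∧
        (∀ K j, Set.InjOn (cells K j) ↑((L.All K).filter fun X => R.u3.C.scale X + Koff = j)) ∧
        (∀ K, ∀ X ∈ L.All K, torusTreeLen (cells K (R.u3.C.scale X + Koff) X) ≤ R.u3.C.d X) ∧
        0 < θ ∧ θ ^ 6 = ((R.ne3.L : ℝ))⁻¹ ∧
        (∀ v ∈ Rd.dom, rd v ∈ R.ne3.dom) ∧
        (∀ k, ∀ v ∈ Rd.dom, Rd.act k v = minAct 4 (sfClass 4 R.ne3.L R.ne3.Nper R.ne3.ε) R.ne3.L R.ne3.Nper k (rd v)) ∧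
        (R.ne3.Nper : ℝ) ^ 4 ≤ Rd.vol ∧
        (∀ s ∈ Window γ, 0 < bsel s ∧ bsel s ≤ γ))
    (hH3 : ∀ (F : T4Family) (θ : Stage13HParams F N) (hP : θ.Provisos₁₃CoPH F N) (g₀ : ℕ → ℝ) (os : List (ULoop F)) (k : ℕ),
      LeafH3sup 4 (rateCarriersOfRecord₁₃CoPH 𝔯 F θ hP g₀ os k).ne3.L (rateCarriersOfRecord₁₃CoPH 𝔯 F θ hP g₀ os k).ne3.Nper (rateCarriersOfRecord₁₃CoPH 𝔯 F θ hP g₀ os k).ne3.ε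
        (rateCarriersOfRecord₁₃CoPH 𝔯 F θ hP g₀ os k).ne3.b (c' F) (rateCarriersOfRecord₁₃CoPH 𝔯 F θ hP g₀ os k).ne3.dom)
    (hsel : ∀ (F : T4Family) (θ : Stage13HParams F N) (hP : θ.Provisos₁₃CoPH F N) (g₀ : ℕ → ℝ) (os : List (ULoop F)) (k : ℕ),
      ∃ sel : ℕ → (B7Prop1Explicit.Site 4 → Fin 4 → (Matrix (Fin N) (Fin N) ℂ)ˣ) → (B7Prop1Explicit.Site 4 → Fin 4 → (Matrix (Fin N) (Fin N) ℂ)ˣ),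
        (∀ V ∈ (rateCarriersOfRecord₁₃CoPH 𝔯 F θ hP g₀ os k).ne3.dom, ∀ j : ℕ,
          IsMinimiser 4 (sfClass 4 (rateCarriersOfRecord₁₃CoPH 𝔯 F θ hP g₀ os k).ne3.L (rateCarriersOfRecord₁₃CoPH 𝔯 F θ hP g₀ os k).ne3.Nper (rateCarriersOfRecord₁₃CoPH 𝔯 F θ hP g₀ os k).ne3.ε)
            (rateCarriersOfRecord₁₃CoPH 𝔯 F θ hP g₀ os k).ne3.L (rateCarriersOfRecord₁₃CoPH 𝔯 F θ hP g₀ os k).ne3.Nper j V (sel j V)) ∧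
        (∀ V ∈ (rateCarriersOfRecord₁₃CoPH 𝔯 F θ hP g₀ os k).ne3.dom, ∀ j : ℕ,
          RegularSup 4 (rateCarriersOfRecord₁₃CoPH 𝔯 F θ hP g₀ os k).ne3.L (rateCarriersOfRecord₁₃CoPH 𝔯 F θ hP g₀ os k).ne3.Nper (rateCarriersOfRecord₁₃CoPH 𝔯 F θ hP g₀ os k).ne3.b (c' F) j (sel j V)))
    (hβ23 : 2 / 3 < β) (hpin1 : Ne1PinnedOfRecord 𝔯)
    (ℓ : (F : T4Family) → Stage13HParams F N → U3Letters₁₁)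
    (hpinU3 : ∀ (F : T4Family) (θ : Stage13HParams F N) (hP : θ.Provisos₁₃CoPH F N) (g₀ : ℕ → ℝ) (os : List (ULoop F)),
      (𝔯.lit F θ hP g₀ os).u3 = objectsOfRecord₁₃ F N θ.toStage13Params (ℓ F θ))
    (hκ₀ : ∀ (F : T4Family) (θ : Stage13HParams F N), θ.Provisos₁₃CoPH F N → G θ → θ.Admissible F N → kappa₀ (4 * 2 ^ 4) (2 * 4) ≤ (ℓ F θ).κ)
    (hpinL : N16PinnedLoose 𝔯 ℓ₃ B) (hmatch : ∀ F : T4Family, 0 < B F ∧ (ℓ₃ F).ε / B F ≤ (ℓ₃ F).b) (hend : N16LettersEnd N g ℓ₃)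
    (hradii : ∀ F : T4Family, (ℓ₃ F).g = gradConst 4 (c' F) ∧ 0 ≤ c' F ∧ 0 < c' F ∧ (ℓ₃ F).b ≤ c' F ∧
      (2 : ℝ) ^ 91 * (F.L : ℝ) ^ 17 * c' F ≤ 1 ∧ (2 : ℝ) ^ 76 * (F.L : ℝ) ^ 12 * c' F ≤ (ℓ₃ F).ε ∧ (ℓ₃ F).ε / B F ≤ 1 / 4 ∧ 4 * ((ℓ₃ F).ε / B F) ≤ c' F)
    (hclass : ∀ F : T4Family, 16 * B7Prop2Explicit.C0 4 * (ℓ₃ F).ε ≤ 3 ∧ 1024 * (4 + 1) * (4 + 4) * (F.L : ℝ) ^ 2 * (ℓ₃ F).ε ≤ 1)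
    (h510 : ∀ (F : T4Family) (θ : Stage13HParams F N), θ.Provisos₁₃CoPH F N → G θ → θ.Admissible F N →
      ∀ μ ν : Fin 4, KernelDecayOfRecord₁₃ F N θ.toStage13Params μ ν (ℓ F θ).κ)
    (F : T4Family) (θ : Stage13HParams F N) (hP : θ.Provisos₁₃CoPH F N) (hG : G θ) (hθ : θ.Admissible F N) {γ₀ b b' : ℝ} (hγ₀ : 0 < γ₀) (hb0 : 0 < b)
    (hβ : DagBinding.BetaBoundsInInterval (datumOfRecord₁₃CoPH F N θ hP).C.toB12 γ₀ b b') {M ρ₁ : ℝ} (hM : 0 ≤ M) (hρ₁ : ρ₁ < 1)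
    (hunif : ∀ (g₀ : ℕ → ℝ) (os : List (ULoop F)) (k : ℕ), 0 < (rateCarriersOfRecord₁₃CoPH 𝔯 F θ hP g₀ os k).u3.ρ ∧
      (rateCarriersOfRecord₁₃CoPH 𝔯 F θ hP g₀ os k).u3.ρ ≤ ρ₁ ∧
      (rateCarriersOfRecord₁₃CoPH 𝔯 F θ hP g₀ os k).u3.cr * (rateCarriersOfRecord₁₃CoPH 𝔯 F θ hP g₀ os k).u3.C₉ * (rateCarriersOfRecord₁₃CoPH 𝔯 F θ hP g₀ os k).u3.ω ≤ M) :
    ForSmallCouplings (datumOfRecord₁₃CoPH F N θ hP) fun g₀ => ∀ (os : List (ULoop F)) (k : ℕ),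
      (RatesHolderAt (datumOfRecord₁₃CoPH F N θ hP) (rateCarriersOfRecord₁₃CoPH 𝔯 F θ hP g₀ os k) β ∧
        ReadOutAt (datumOfRecord₁₃CoPH F N θ hP) (rateCarriersOfRecord₁₃CoPH 𝔯 F θ hP g₀ os k).u3 ∧
        (0 ≤ (rateCarriersOfRecord₁₃CoPH 𝔯 F θ hP g₀ os k).u3.ρ ∧ (rateCarriersOfRecord₁₃CoPH 𝔯 F θ hP g₀ os k).u3.ρ < 1)) →
        letI := (crOfRecord₁₃VAt K₀ (jc F θ hP g₀ os) sh F θ hP g₀ os).dec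
        ∃ δ : ℕ → ℝ, NE7.Core (crOfRecord₁₃VAt K₀ (jc F θ hP g₀ os) sh F θ hP g₀ os).l₀ (crOfRecord₁₃VAt K₀ (jc F θ hP g₀ os) sh F θ hP g₀ os).vol (crOfRecord₁₃VAt K₀ (jc F θ hP g₀ os) sh F θ hP g₀ os).T (crOfRecord₁₃VAt K₀ (jc F θ hP g₀ os) sh F θ hP g₀ os).Bad
          (fun K t τ => (crOfRecord₁₃VAt K₀ (jc F θ hP g₀ os) sh F θ hP g₀ os).A K t τ - (crOfRecord₁₃VAt K₀ (jc F θ hP g₀ os) sh F θ hP g₀ os).shA K t τ) (fun K t τ => (crOfRecord₁₃VAt K₀ (jc F θ hP g₀ os) sh F θ hP g₀ os).B K t τ - (crOfRecord₁₃VAt K₀ (jc F θ hP g₀ os) sh F θ hP g₀ os).shB K t τ) δ ∧ Summable δ :=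
  forSmallCouplings_h19HolderD4_datumOfRecord₁₃CoPH_of_linkReadingAtCoreLedgerReading_of_kernelDecayAll
    (fun F θ hP g₀ os => crOfRecord₁₃VAt K₀ (jc F θ hP g₀ os) sh F θ hP g₀ os) 𝔯 G hβ1
    (linkReadingAtCoreLedgerReading_crOfRecord₁₃VAt_of_linkReadingAtCoreLedgerReadingV K₀ jc sh 𝔯 G
      (linkReadingAtCoreLedgerReadingV_of_linkReadingAtBareLedgerReadingV K₀ jc sh 𝔯 G hlinkBareV hH3 hsel) ℓ hpinU3 hκ₀)
    hβ23 hpin1 ℓ hpinU3 hpinL hmatch hend hradii hclass h510 F θ hP hG hθ hγ₀ hb0 hβ hM hρ₁ hunif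

/-! ## §2 K3 «v6»'s (B)-free N19′ face, SPELLED, at the witness reading, bare ledger reading — node U3's share = (R1)(R2)(R3) -/

include hβ1 in
/-- ★★★ **K3 «v6»'s (B)-FREE N19′ FACE `KeyedCoreEdgeHolderD4BFree β (fun … ↦ S) (rrOfRecord 𝔯 ks)`, SPELLED, AT THE WITNESS READING, BARE LEDGER READING — NODE U3's SHARE = THREE
LETTER ROWS** [bookkeeping]: dag-n19-w3's p639742 §2 CONCLUSION VERBATIM from `hlinkBareV`, `hH3 hsel`, the three pins, `hmatch hend hradii hclass`, `2∕3 < β ≤ 1`, K1⁷'s interval-form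
window with `0 < b` (`hβw`), and — on node U3's side — ONLY (R1) `h510`, (R2) `hρ : 0 < (ℓ F θ).ρ`, (R3) `hκ₀`; FILE 9 §4 at `cr := fun … ↦ S` with NODE O's core reading from p638503 §1 ∘
p639742 §1.  p639742 §2 asks node U3 for `hs r hr hinc h9 hWall hκ₀`.  All HYPOTHESES; NOT the stub, NOT K3⁸; N07 ∕ N14 ∕ N16 ∕ N18 ∕ N19 ∕ N22 NOT discharged. -/
theorem keyedCoreEdgeHolderD4BFree_crOfRecord₁₃VAt_of_linkReadingAtBareLedgerReadingV_of_kernelDecayAll_of_rhoPos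
    (hlinkBareV : ∀ (F : T4Family) (θ : Stage13HParams F N) (hP : θ.Provisos₁₃CoPH F N), G θ → θ.Admissible F N →
    ∀ (γ gIR b : ℝ) (g₀ : ℕ → ℝ), (datumOfRecord₁₃CoPH F N θ hP).Tuned γ gIR g₀ → γ ≤ θ.γ → γ ^ 2 ≤ Real.exp (-1) → 0 < b →
    (∀ K m, 0 ≤ m → m < K → b ≤ (datumOfRecord₁₃CoPH F N θ hP).βfun m (prefixOf (runFlow (datumOfRecord₁₃CoPH F N θ hP) g₀ K) m)) →
    ∀ (os : List (ULoop F)) (k : ℕ),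
      let S : SpineCarriers := crOfRecord₁₃VAt K₀ (jc F θ hP g₀ os) sh F θ hP g₀ os
      let R : RateCarriers N := rateCarriersOfRecord₁₃CoPH 𝔯 F θ hP g₀ os k
      let D : Datum F N := datumOfRecord₁₃CoPH F N θ hP
      letI := S.dec
      ∃ (_ : DecidableEq R.u3.C.Dom) (F' : Type) (ι' X' : Type) (_ : MeasurableSpace ι')
        (L : LedgerDataSync R.u3.C F' ι' S.ι) (Rd : Readings ι' X') (bsel : (ℕ → ℝ) → ℝ) (EB : Functional R.u3.C R.u3.C.BgB)
        (g : ℕ → ℕ → ℝ)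
        (uA : ℕ → ι' → R.u3.C.BgA) (uB : ℕ → ι' → R.u3.C.BgB)
        (Koff : ℕ) (cells : (K j : ℕ) → R.u3.C.Dom → Finset (Site (F.P (Koff + K)) j))
        (θ : ℝ)
        (rd : ι' → (B7Prop1Explicit.Site 4 → Fin 4 → (Matrix (Fin N) (Fin N) ℂ)ˣ)),
        (∀ K i, i ≤ K → g K i = runFlow D g₀ K i) ∧ (∀ K i, K < i → g K i = gIR) ∧
        EB = (fun s => R.u3.EB (bsel s) s) ∧
        (∀ (Sz : ℕ → ℝ → S.ι → ℕ → ℝ) (E₀ : ℝ) (m : ℕ) (a : ℝ) (Cw Λg : ℝ),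
          (∀ K t, |t| ≤ S.l₀ → ∀ τ ∈ S.T K \ S.Bad K t, ∀ v ∈ Rd.dom, ∀ j ≤ K,
            |∑ X ∈ L.fac K t τ with R.u3.C.scale X = j,
                (Real.log (Real.exp (EB (fun i => g (K + 1) (i + 1)) (uB K v) X
                    - EB (fun i => g (K + 1) (i + 1)) L.oneB X))
                  - Real.log (Real.exp (R.u3.EA (g K) (uA K v) X - R.u3.EA (g K) L.oneA X)))| ≤ Sz K t τ j) →
          0 ≤ E₀ → 0 < a → a < 1 →
          (∀ K t, |t| ≤ S.l₀ → ∀ τ ∈ S.T K \ S.Bad K t, ∀ j ≤ K,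
            Sz K t τ j ≤ S.vol * (E₀ * ((K : ℝ) + 1) ^ m * a ^ (K - j))) →
          (∀ K, Multiplicity (L.All K) R.u3.C.scale (fun X => Real.exp (-(R.u3.κ * R.u3.C.d X))) Cw S.vol Λg K) →
          (∀ K t, |t| ≤ S.l₀ → ∀ τ ∈ S.T K \ S.Bad K t,
            WindowMultiplicity (L.facO K t τ) L.scO L.wO Cw S.vol Λg (jlogOf L.Cl K) K) →
          1 ≤ Λg → L.θ' ≤ Λg →
          LedgerAtSync { L with S := Sz, E₀ := E₀, m := m, a := a, Cw := Cw, Λg := Λg } S.l₀ S.vol S.T S.Bad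
            (fun K t τ => S.A K t τ - S.shA K t τ) (fun K t τ => S.B K t τ - S.shB K t τ) Rd R.u3.EA EB R.u3.κ g uA uB
            R.u3.ω R.u3.ρ R.u3.θ (θ ^ ((3 : ℝ) * β - 2))) ∧
        (∀ K t, |t| ≤ S.l₀ → ∀ τ ∈ S.T K \ S.Bad K t,
          WindowMultiplicity (L.facO K t τ) L.scO L.wO L.Cw S.vol L.Λg (jlogOf L.Cl K) K) ∧
        0 ≤ L.Cw ∧ 1 ≤ L.Λg ∧ L.θ' ≤ L.Λg ∧
        (∀ K, ∀ X ∈ L.All K,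
          (cells K (R.u3.C.scale X + Koff) X).Nonempty ∧ TFaceConnected (cells K (R.u3.C.scale X + Koff) X)) ∧
        (∀ K j, Set.InjOn (cells K j) ↑((L.All K).filter fun X => R.u3.C.scale X + Koff = j)) ∧
        (∀ K, ∀ X ∈ L.All K, torusTreeLen (cells K (R.u3.C.scale X + Koff) X) ≤ R.u3.C.d X) ∧
        0 < θ ∧ θ ^ 6 = ((R.ne3.L : ℝ))⁻¹ ∧
        (∀ v ∈ Rd.dom, rd v ∈ R.ne3.dom) ∧
        (∀ k, ∀ v ∈ Rd.dom, Rd.act k v = minAct 4 (sfClass 4 R.ne3.L R.ne3.Nper R.ne3.ε) R.ne3.L R.ne3.Nper k (rd v)) ∧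
        (R.ne3.Nper : ℝ) ^ 4 ≤ Rd.vol ∧
        (∀ s ∈ Window γ, 0 < bsel s ∧ bsel s ≤ γ))
    (hH3 : ∀ (F : T4Family) (θ : Stage13HParams F N) (hP : θ.Provisos₁₃CoPH F N) (g₀ : ℕ → ℝ) (os : List (ULoop F)) (k : ℕ),
      LeafH3sup 4 (rateCarriersOfRecord₁₃CoPH 𝔯 F θ hP g₀ os k).ne3.L (rateCarriersOfRecord₁₃CoPH 𝔯 F θ hP g₀ os k).ne3.Nper (rateCarriersOfRecord₁₃CoPH 𝔯 F θ hP g₀ os k).ne3.ε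
        (rateCarriersOfRecord₁₃CoPH 𝔯 F θ hP g₀ os k).ne3.b (c' F) (rateCarriersOfRecord₁₃CoPH 𝔯 F θ hP g₀ os k).ne3.dom)
    (hsel : ∀ (F : T4Family) (θ : Stage13HParams F N) (hP : θ.Provisos₁₃CoPH F N) (g₀ : ℕ → ℝ) (os : List (ULoop F)) (k : ℕ),
      ∃ sel : ℕ → (B7Prop1Explicit.Site 4 → Fin 4 → (Matrix (Fin N) (Fin N) ℂ)ˣ) → (B7Prop1Explicit.Site 4 → Fin 4 → (Matrix (Fin N) (Fin N) ℂ)ˣ),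
        (∀ V ∈ (rateCarriersOfRecord₁₃CoPH 𝔯 F θ hP g₀ os k).ne3.dom, ∀ j : ℕ,
          IsMinimiser 4 (sfClass 4 (rateCarriersOfRecord₁₃CoPH 𝔯 F θ hP g₀ os k).ne3.L (rateCarriersOfRecord₁₃CoPH 𝔯 F θ hP g₀ os k).ne3.Nper (rateCarriersOfRecord₁₃CoPH 𝔯 F θ hP g₀ os k).ne3.ε)
            (rateCarriersOfRecord₁₃CoPH 𝔯 F θ hP g₀ os k).ne3.L (rateCarriersOfRecord₁₃CoPH 𝔯 F θ hP g₀ os k).ne3.Nper j V (sel j V)) ∧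
        (∀ V ∈ (rateCarriersOfRecord₁₃CoPH 𝔯 F θ hP g₀ os k).ne3.dom, ∀ j : ℕ,
          RegularSup 4 (rateCarriersOfRecord₁₃CoPH 𝔯 F θ hP g₀ os k).ne3.L (rateCarriersOfRecord₁₃CoPH 𝔯 F θ hP g₀ os k).ne3.Nper (rateCarriersOfRecord₁₃CoPH 𝔯 F θ hP g₀ os k).ne3.b (c' F) j (sel j V)))
    (hβ23 : 2 / 3 < β) (hpin1 : Ne1PinnedOfRecord 𝔯)
    (ℓ : (F : T4Family) → Stage13HParams F N → U3Letters₁₁)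
    (hpinU3 : ∀ (F : T4Family) (θ : Stage13HParams F N) (hP : θ.Provisos₁₃CoPH F N) (g₀ : ℕ → ℝ) (os : List (ULoop F)),
      (𝔯.lit F θ hP g₀ os).u3 = objectsOfRecord₁₃ F N θ.toStage13Params (ℓ F θ))
    (hκ₀ : ∀ (F : T4Family) (θ : Stage13HParams F N), θ.Provisos₁₃CoPH F N → G θ → θ.Admissible F N → kappa₀ (4 * 2 ^ 4) (2 * 4) ≤ (ℓ F θ).κ)
    (hpinL : N16PinnedLoose 𝔯 ℓ₃ B) (hmatch : ∀ F : T4Family, 0 < B F ∧ (ℓ₃ F).ε / B F ≤ (ℓ₃ F).b) (hend : N16LettersEnd N g ℓ₃)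
    (hradii : ∀ F : T4Family, (ℓ₃ F).g = gradConst 4 (c' F) ∧ 0 ≤ c' F ∧ 0 < c' F ∧ (ℓ₃ F).b ≤ c' F ∧
      (2 : ℝ) ^ 91 * (F.L : ℝ) ^ 17 * c' F ≤ 1 ∧ (2 : ℝ) ^ 76 * (F.L : ℝ) ^ 12 * c' F ≤ (ℓ₃ F).ε ∧ (ℓ₃ F).ε / B F ≤ 1 / 4 ∧ 4 * ((ℓ₃ F).ε / B F) ≤ c' F)
    (hclass : ∀ F : T4Family, 16 * B7Prop2Explicit.C0 4 * (ℓ₃ F).ε ≤ 3 ∧ 1024 * (4 + 1) * (4 + 4) * (F.L : ℝ) ^ 2 * (ℓ₃ F).ε ≤ 1)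
    (h510 : ∀ (F : T4Family) (θ : Stage13HParams F N), θ.Provisos₁₃CoPH F N → G θ → θ.Admissible F N →
      ∀ μ ν : Fin 4, KernelDecayOfRecord₁₃ F N θ.toStage13Params μ ν (ℓ F θ).κ)
    (hρ : ∀ (F : T4Family) (θ : Stage13HParams F N), θ.Provisos₁₃CoPH F N → G θ → θ.Admissible F N → 0 < (ℓ F θ).ρ)
    (ks : (F : T4Family) → (θ : Stage13HParams F N) → θ.Provisos₁₃CoPH F N → (ℕ → ℝ) → List (ULoop F) → ℕ)
    (hβw : ∀ (F : T4Family) (θ : Stage13HParams F N) (hP : θ.Provisos₁₃CoPH F N), G θ → θ.Admissible F N →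
      ∃ γ₀ b b' : ℝ, 0 < γ₀ ∧ 0 < b ∧ DagBinding.BetaBoundsInInterval (datumOfRecord₁₃CoPH F N θ hP).C.toB12 γ₀ b b') :
    ∀ (F : T4Family) (θ : Stage13HParams F N) (hP : θ.Provisos₁₃CoPH F N), G θ → θ.Admissible F N →
      ForSmallCouplings (datumOfRecord₁₃CoPH F N θ hP) fun g₀ => ∀ os : List (ULoop F),
        (RatesHolderAt (datumOfRecord₁₃CoPH F N θ hP) (rateCarriersOfRecord₁₃CoPH 𝔯 F θ hP g₀ os (ks F θ hP g₀ os)) β ∧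
          ReadOutAt (datumOfRecord₁₃CoPH F N θ hP) (rateCarriersOfRecord₁₃CoPH 𝔯 F θ hP g₀ os (ks F θ hP g₀ os)).u3 ∧
          (0 ≤ (rateCarriersOfRecord₁₃CoPH 𝔯 F θ hP g₀ os (ks F θ hP g₀ os)).u3.ρ ∧ (rateCarriersOfRecord₁₃CoPH 𝔯 F θ hP g₀ os (ks F θ hP g₀ os)).u3.ρ < 1)) →
        letI := (crOfRecord₁₃VAt K₀ (jc F θ hP g₀ os) sh F θ hP g₀ os).dec
        ∃ δ : ℕ → ℝ, NE7.Core (crOfRecord₁₃VAt K₀ (jc F θ hP g₀ os) sh F θ hP g₀ os).l₀ (crOfRecord₁₃VAt K₀ (jc F θ hP g₀ os) sh F θ hP g₀ os).vol (crOfRecord₁₃VAt K₀ (jc F θ hP g₀ os) sh F θ hP g₀ os).T (crOfRecord₁₃VAt K₀ (jc F θ hP g₀ os) sh F θ hP g₀ os).Bad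
          (fun K t τ => (crOfRecord₁₃VAt K₀ (jc F θ hP g₀ os) sh F θ hP g₀ os).A K t τ - (crOfRecord₁₃VAt K₀ (jc F θ hP g₀ os) sh F θ hP g₀ os).shA K t τ) (fun K t τ => (crOfRecord₁₃VAt K₀ (jc F θ hP g₀ os) sh F θ hP g₀ os).B K t τ - (crOfRecord₁₃VAt K₀ (jc F θ hP g₀ os) sh F θ hP g₀ os).shB K t τ) δ ∧ Summable δ :=
  keyedCoreEdgeHolderD4BFree_of_linkReadingAtCoreLedgerReading_of_kernelDecayAll_of_rhoPos
    (fun F θ hP g₀ os => crOfRecord₁₃VAt K₀ (jc F θ hP g₀ os) sh F θ hP g₀ os) 𝔯 G hβ1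
    (linkReadingAtCoreLedgerReading_crOfRecord₁₃VAt_of_linkReadingAtCoreLedgerReadingV K₀ jc sh 𝔯 G
      (linkReadingAtCoreLedgerReadingV_of_linkReadingAtBareLedgerReadingV K₀ jc sh 𝔯 G hlinkBareV hH3 hsel) ℓ hpinU3 hκ₀)
    hβ23 hpin1 ℓ hpinU3 hpinL hmatch hend hradii hclass h510 hρ ks hβw

/-! ## §3 The same bill in STUB 1's OWN ROW CURRENCY: `hs` + `hL` + the windowed (5.10) letter at 16 pairs + `hκ₀` — `h9`, `r hr hinc`, `hdecT`, `hunif` GONE -/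

include hβ1 in
/-- ★★ **THE FACE-KEYED N19′ BILL AT THE WITNESS READING IN STUB 1's ROW CURRENCY** [bookkeeping]: §2 with (R1) supplied from def-W1's letters `hL : PolLimitsExistOfRecord₁₃` and
`hWall : ∀ μ ν, WindowedDecayOfRecord₁₃ … μ ν (ℓ F θ).κ` (dag-n22-w3 `kernelDecayOfRecord₁₃_of_windowed`, per pair) and (R2) from `hs : (ℓ F θ).Signs` (FILE 5 `rho_row_of_signs`: `0 < θ₅ ≤ ρ`).
So in stub 1's currency (`K3V6StubsLetterForm` §4: `hs hκ hcr hρ hL h9 hW hS`) node U3's share of the N19′ face at the witness reading is `hs` + `hL` + `hW` AT ALL 16 PAIRS + `hκ₀` — windowed NE9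
`h9` (and p639742 §2's `r hr hinc`) is NOT needed: NE9 of the LIMITING kernels is READ OFF THE FACE (`N22At`).  All HYPOTHESES; NOT the stub, NOT K3⁸; N07 ∕ N14 ∕ N16 ∕ N18 ∕ N19 ∕ N22 NOT discharged. -/
theorem keyedCoreEdgeHolderD4BFree_crOfRecord₁₃VAt_of_linkReadingAtBareLedgerReadingV_of_windowedAll_of_signs
    (hlinkBareV : ∀ (F : T4Family) (θ : Stage13HParams F N) (hP : θ.Provisos₁₃CoPH F N), G θ → θ.Admissible F N →
    ∀ (γ gIR b : ℝ) (g₀ : ℕ → ℝ), (datumOfRecord₁₃CoPH F N θ hP).Tuned γ gIR g₀ → γ ≤ θ.γ → γ ^ 2 ≤ Real.exp (-1) → 0 < b →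
    (∀ K m, 0 ≤ m → m < K → b ≤ (datumOfRecord₁₃CoPH F N θ hP).βfun m (prefixOf (runFlow (datumOfRecord₁₃CoPH F N θ hP) g₀ K) m)) →
    ∀ (os : List (ULoop F)) (k : ℕ),
      let S : SpineCarriers := crOfRecord₁₃VAt K₀ (jc F θ hP g₀ os) sh F θ hP g₀ os
      let R : RateCarriers N := rateCarriersOfRecord₁₃CoPH 𝔯 F θ hP g₀ os k
      let D : Datum F N := datumOfRecord₁₃CoPH F N θ hP
      letI := S.dec
      ∃ (_ : DecidableEq R.u3.C.Dom) (F' : Type) (ι' X' : Type) (_ : MeasurableSpace ι')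
        (L : LedgerDataSync R.u3.C F' ι' S.ι) (Rd : Readings ι' X') (bsel : (ℕ → ℝ) → ℝ) (EB : Functional R.u3.C R.u3.C.BgB)
        (g : ℕ → ℕ → ℝ)
        (uA : ℕ → ι' → R.u3.C.BgA) (uB : ℕ → ι' → R.u3.C.BgB)
        (Koff : ℕ) (cells : (K j : ℕ) → R.u3.C.Dom → Finset (Site (F.P (Koff + K)) j))
        (θ : ℝ)
        (rd : ι' → (B7Prop1Explicit.Site 4 → Fin 4 → (Matrix (Fin N) (Fin N) ℂ)ˣ)),
        (∀ K i, i ≤ K → g K i = runFlow D g₀ K i) ∧ (∀ K i, K < i → g K i = gIR) ∧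
        EB = (fun s => R.u3.EB (bsel s) s) ∧
        (∀ (Sz : ℕ → ℝ → S.ι → ℕ → ℝ) (E₀ : ℝ) (m : ℕ) (a : ℝ) (Cw Λg : ℝ),
          (∀ K t, |t| ≤ S.l₀ → ∀ τ ∈ S.T K \ S.Bad K t, ∀ v ∈ Rd.dom, ∀ j ≤ K,
            |∑ X ∈ L.fac K t τ with R.u3.C.scale X = j,
                (Real.log (Real.exp (EB (fun i => g (K + 1) (i + 1)) (uB K v) X
                    - EB (fun i => g (K + 1) (i + 1)) L.oneB X))
                  - Real.log (Real.exp (R.u3.EA (g K) (uA K v) X - R.u3.EA (g K) L.oneA X)))| ≤ Sz K t τ j) →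
          0 ≤ E₀ → 0 < a → a < 1 →
          (∀ K t, |t| ≤ S.l₀ → ∀ τ ∈ S.T K \ S.Bad K t, ∀ j ≤ K,
            Sz K t τ j ≤ S.vol * (E₀ * ((K : ℝ) + 1) ^ m * a ^ (K - j))) →
          (∀ K, Multiplicity (L.All K) R.u3.C.scale (fun X => Real.exp (-(R.u3.κ * R.u3.C.d X))) Cw S.vol Λg K) →
          (∀ K t, |t| ≤ S.l₀ → ∀ τ ∈ S.T K \ S.Bad K t,
            WindowMultiplicity (L.facO K t τ) L.scO L.wO Cw S.vol Λg (jlogOf L.Cl K) K) →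
          1 ≤ Λg → L.θ' ≤ Λg →
          LedgerAtSync { L with S := Sz, E₀ := E₀, m := m, a := a, Cw := Cw, Λg := Λg } S.l₀ S.vol S.T S.Bad
            (fun K t τ => S.A K t τ - S.shA K t τ) (fun K t τ => S.B K t τ - S.shB K t τ) Rd R.u3.EA EB R.u3.κ g uA uB
            R.u3.ω R.u3.ρ R.u3.θ (θ ^ ((3 : ℝ) * β - 2))) ∧
        (∀ K t, |t| ≤ S.l₀ → ∀ τ ∈ S.T K \ S.Bad K t,
          WindowMultiplicity (L.facO K t τ) L.scO L.wO L.Cw S.vol L.Λg (jlogOf L.Cl K) K) ∧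
        0 ≤ L.Cw ∧ 1 ≤ L.Λg ∧ L.θ' ≤ L.Λg ∧
        (∀ K, ∀ X ∈ L.All K,
          (cells K (R.u3.C.scale X + Koff) X).Nonempty ∧ TFaceConnected (cells K (R.u3.C.scale X + Koff) X)) ∧
        (∀ K j, Set.InjOn (cells K j) ↑((L.All K).filter fun X => R.u3.C.scale X + Koff = j)) ∧
        (∀ K, ∀ X ∈ L.All K, torusTreeLen (cells K (R.u3.C.scale X + Koff) X) ≤ R.u3.C.d X) ∧
        0 < θ ∧ θ ^ 6 = ((R.ne3.L : ℝ))⁻¹ ∧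
        (∀ v ∈ Rd.dom, rd v ∈ R.ne3.dom) ∧
        (∀ k, ∀ v ∈ Rd.dom, Rd.act k v = minAct 4 (sfClass 4 R.ne3.L R.ne3.Nper R.ne3.ε) R.ne3.L R.ne3.Nper k (rd v)) ∧
        (R.ne3.Nper : ℝ) ^ 4 ≤ Rd.vol ∧
        (∀ s ∈ Window γ, 0 < bsel s ∧ bsel s ≤ γ))
    (hH3 : ∀ (F : T4Family) (θ : Stage13HParams F N) (hP : θ.Provisos₁₃CoPH F N) (g₀ : ℕ → ℝ) (os : List (ULoop F)) (k : ℕ),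
      LeafH3sup 4 (rateCarriersOfRecord₁₃CoPH 𝔯 F θ hP g₀ os k).ne3.L (rateCarriersOfRecord₁₃CoPH 𝔯 F θ hP g₀ os k).ne3.Nper (rateCarriersOfRecord₁₃CoPH 𝔯 F θ hP g₀ os k).ne3.ε
        (rateCarriersOfRecord₁₃CoPH 𝔯 F θ hP g₀ os k).ne3.b (c' F) (rateCarriersOfRecord₁₃CoPH 𝔯 F θ hP g₀ os k).ne3.dom)
    (hsel : ∀ (F : T4Family) (θ : Stage13HParams F N) (hP : θ.Provisos₁₃CoPH F N) (g₀ : ℕ → ℝ) (os : List (ULoop F)) (k : ℕ),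
      ∃ sel : ℕ → (B7Prop1Explicit.Site 4 → Fin 4 → (Matrix (Fin N) (Fin N) ℂ)ˣ) → (B7Prop1Explicit.Site 4 → Fin 4 → (Matrix (Fin N) (Fin N) ℂ)ˣ),
        (∀ V ∈ (rateCarriersOfRecord₁₃CoPH 𝔯 F θ hP g₀ os k).ne3.dom, ∀ j : ℕ,
          IsMinimiser 4 (sfClass 4 (rateCarriersOfRecord₁₃CoPH 𝔯 F θ hP g₀ os k).ne3.L (rateCarriersOfRecord₁₃CoPH 𝔯 F θ hP g₀ os k).ne3.Nper (rateCarriersOfRecord₁₃CoPH 𝔯 F θ hP g₀ os k).ne3.ε)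
            (rateCarriersOfRecord₁₃CoPH 𝔯 F θ hP g₀ os k).ne3.L (rateCarriersOfRecord₁₃CoPH 𝔯 F θ hP g₀ os k).ne3.Nper j V (sel j V)) ∧
        (∀ V ∈ (rateCarriersOfRecord₁₃CoPH 𝔯 F θ hP g₀ os k).ne3.dom, ∀ j : ℕ,
          RegularSup 4 (rateCarriersOfRecord₁₃CoPH 𝔯 F θ hP g₀ os k).ne3.L (rateCarriersOfRecord₁₃CoPH 𝔯 F θ hP g₀ os k).ne3.Nper (rateCarriersOfRecord₁₃CoPH 𝔯 F θ hP g₀ os k).ne3.b (c' F) j (sel j V)))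
    (hβ23 : 2 / 3 < β) (hpin1 : Ne1PinnedOfRecord 𝔯)
    (ℓ : (F : T4Family) → Stage13HParams F N → U3Letters₁₁)
    (hpinU3 : ∀ (F : T4Family) (θ : Stage13HParams F N) (hP : θ.Provisos₁₃CoPH F N) (g₀ : ℕ → ℝ) (os : List (ULoop F)),
      (𝔯.lit F θ hP g₀ os).u3 = objectsOfRecord₁₃ F N θ.toStage13Params (ℓ F θ))
    (hκ₀ : ∀ (F : T4Family) (θ : Stage13HParams F N), θ.Provisos₁₃CoPH F N → G θ → θ.Admissible F N → kappa₀ (4 * 2 ^ 4) (2 * 4) ≤ (ℓ F θ).κ)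
    (hpinL : N16PinnedLoose 𝔯 ℓ₃ B) (hmatch : ∀ F : T4Family, 0 < B F ∧ (ℓ₃ F).ε / B F ≤ (ℓ₃ F).b) (hend : N16LettersEnd N g ℓ₃)
    (hradii : ∀ F : T4Family, (ℓ₃ F).g = gradConst 4 (c' F) ∧ 0 ≤ c' F ∧ 0 < c' F ∧ (ℓ₃ F).b ≤ c' F ∧
      (2 : ℝ) ^ 91 * (F.L : ℝ) ^ 17 * c' F ≤ 1 ∧ (2 : ℝ) ^ 76 * (F.L : ℝ) ^ 12 * c' F ≤ (ℓ₃ F).ε ∧ (ℓ₃ F).ε / B F ≤ 1 / 4 ∧ 4 * ((ℓ₃ F).ε / B F) ≤ c' F)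
    (hclass : ∀ F : T4Family, 16 * B7Prop2Explicit.C0 4 * (ℓ₃ F).ε ≤ 3 ∧ 1024 * (4 + 1) * (4 + 4) * (F.L : ℝ) ^ 2 * (ℓ₃ F).ε ≤ 1)
    (hs : ∀ (F : T4Family) (θ : Stage13HParams F N), θ.Provisos₁₃CoPH F N → G θ → θ.Admissible F N → (ℓ F θ).Signs)
    (hL : ∀ (F : T4Family) (θ : Stage13HParams F N), θ.Provisos₁₃CoPH F N → G θ → θ.Admissible F N → PolLimitsExistOfRecord₁₃ F N θ.toStage13Params)
    (hWall : ∀ (μ ν : Fin 4) (F : T4Family) (θ : Stage13HParams F N), θ.Provisos₁₃CoPH F N → G θ → θ.Admissible F N →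
      WindowedDecayOfRecord₁₃ F N θ.toStage13Params μ ν (ℓ F θ).κ)
    (ks : (F : T4Family) → (θ : Stage13HParams F N) → θ.Provisos₁₃CoPH F N → (ℕ → ℝ) → List (ULoop F) → ℕ)
    (hβw : ∀ (F : T4Family) (θ : Stage13HParams F N) (hP : θ.Provisos₁₃CoPH F N), G θ → θ.Admissible F N →
      ∃ γ₀ b b' : ℝ, 0 < γ₀ ∧ 0 < b ∧ DagBinding.BetaBoundsInInterval (datumOfRecord₁₃CoPH F N θ hP).C.toB12 γ₀ b b') :
    ∀ (F : T4Family) (θ : Stage13HParams F N) (hP : θ.Provisos₁₃CoPH F N), G θ → θ.Admissible F N →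
      ForSmallCouplings (datumOfRecord₁₃CoPH F N θ hP) fun g₀ => ∀ os : List (ULoop F),
        (RatesHolderAt (datumOfRecord₁₃CoPH F N θ hP) (rateCarriersOfRecord₁₃CoPH 𝔯 F θ hP g₀ os (ks F θ hP g₀ os)) β ∧
          ReadOutAt (datumOfRecord₁₃CoPH F N θ hP) (rateCarriersOfRecord₁₃CoPH 𝔯 F θ hP g₀ os (ks F θ hP g₀ os)).u3 ∧
          (0 ≤ (rateCarriersOfRecord₁₃CoPH 𝔯 F θ hP g₀ os (ks F θ hP g₀ os)).u3.ρ ∧ (rateCarriersOfRecord₁₃CoPH 𝔯 F θ hP g₀ os (ks F θ hP g₀ os)).u3.ρ < 1)) →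
        letI := (crOfRecord₁₃VAt K₀ (jc F θ hP g₀ os) sh F θ hP g₀ os).dec
        ∃ δ : ℕ → ℝ, NE7.Core (crOfRecord₁₃VAt K₀ (jc F θ hP g₀ os) sh F θ hP g₀ os).l₀ (crOfRecord₁₃VAt K₀ (jc F θ hP g₀ os) sh F θ hP g₀ os).vol (crOfRecord₁₃VAt K₀ (jc F θ hP g₀ os) sh F θ hP g₀ os).T (crOfRecord₁₃VAt K₀ (jc F θ hP g₀ os) sh F θ hP g₀ os).Bad
          (fun K t τ => (crOfRecord₁₃VAt K₀ (jc F θ hP g₀ os) sh F θ hP g₀ os).A K t τ - (crOfRecord₁₃VAt K₀ (jc F θ hP g₀ os) sh F θ hP g₀ os).shA K t τ) (fun K t τ => (crOfRecord₁₃VAt K₀ (jc F θ hP g₀ os) sh F θ hP g₀ os).B K t τ - (crOfRecord₁₃VAt K₀ (jc F θ hP g₀ os) sh F θ hP g₀ os).shB K t τ) δ ∧ Summable δ :=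
  keyedCoreEdgeHolderD4BFree_crOfRecord₁₃VAt_of_linkReadingAtBareLedgerReadingV_of_kernelDecayAll_of_rhoPos K₀ jc sh 𝔯 G hβ1 hlinkBareV hH3 hsel hβ23 hpin1 ℓ hpinU3 hκ₀ hpinL
    hmatch hend hradii hclass
    (fun F θ hP hG hθ μ ν => kernelDecayOfRecord₁₃_of_windowed F N θ.toStage13Params μ ν (ℓ F θ).κ (hL F θ hP hG hθ) (hWall μ ν F θ hP hG hθ))
    (fun F θ hP hG hθ => (rho_row_of_signs (hs F θ hP hG hθ)).1) ks hβw

end AtBareLedgerReadingV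

end Summit.QuantumFields.YangMills.BalabanUVNodes.N19CoreEdgeU3InputsFromFaceAtBareReadingV

end
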